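import Literature.Barriers.CriticalPhenomena.PlaquetteWalkHoleRootKillForcedZeroSchema
import Literature.Probability.RandomPlanarGeometry.YangBaxterSAWHexDictionaryWinding
import HarnessLib

/-!
# Barrier catalogue (SAWScalingLimit): an INTERIOR corner cell does not kill — free wound witnesses around each of the
four kill cells, transported to every position

Leaf of `PlaquetteWalkHoleRootKillForcedZeroSchema` (witness blocks, `refShift`) and of the dictionary's translation
anatomy (`YangBaxterSAWHexDictionaryWinding` §8: `ΩG.isB2a_of_mids_shift`, `ΩG.rayCountAt_W_of_mids_shift`). The venture
lane's LAW L (`FINDING-YB-KILL-FORCED-ZEROS.md` §5) has a kill half — each corner cell `K_S2, K_N1, K_S1, K_N2`, when it is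
a BOUNDARY cell of the box and is removed alone, kills one route at one hexagonal angle (the tree's structural schemas,
`PlaquetteWalkHoleRootWestCorridor` / `…Corridor`, and «LAW L FOR ALL BOXES») — and a non-kill half: «a non-boundary
K-cell removed alone does NOT kill» (scored TRUE on the frames `66a–d`, `76a`, `67a`). This file proves the non-kill half
as a structural WITNESS SCHEMA: for each corner cell there is an explicit 22-arc wound walk of the killed route that is
FREE of the killed weight and avoids the corner cell, drawn in a 20–22-cell block reaching ONE column and ONE row beyond
it (`interiorBlockSW42`, …; found by shortest-first search, HOME `code/step0/g26/nokill/find3.py`; the same search finds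
NO such walk when only the extra row or only the extra column is present — the corridor kills of the boundary case);
the walk is certified by the kernel at the reference position (class `B2a`, first side, freeness by `decide`; woundness by
the odd eastern ray count, `ΩG.WE_ne_excursionWinding_of_odd_card`) and carried to EVERY face list containing a translate
of its block: §1 transports visited faces, arc kinds and freeness along a translation of the mid-edge list
(`YBWalk.W2FreeOff_of_mids_shift`, …), §3 assembles class, first side, woundness (through the `W`-ray count of the root
plaquette, `ΩG.rayCountAt_W_of_mids_shift`) and freeness: ★★★★ `exists_under_w2free_of_interiorBlockSW`,
`exists_over_w1free_of_interiorBlockNW`, `exists_under_w1free_of_interiorBlockSE`, `exists_over_w2free_of_interiorBlockNE`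
— so in any domain containing the block around an absent corner cell that is NOT on its boundary side, the route that
the corner cell would kill is NOT killed (★ `not_under_w2_killed_of_interiorBlockSW`, …).

Not in print; venture lane «pcv-sawmu», seat b-step0 gen 26.

References: A. Glazman, I. Manolescu, arXiv:1708.00395v3, §1 (Fig. 1, Fig. 2), §2.1, §4.2 (translation invariance) and
Lemma 2.1 [GlazmanManolescu2019]; A. Glazman, Electron. Commun. Probab. 20 (2015) no. 86, Lemma 3.1, proof pp. 6–7
[Glazman2015WeightedSAW]; R. Courant, H. Robbins, *What is Mathematics?* (1941/1958), Ch. V Appendix §2 (the even–odd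
rule) [CourantRobbins1958].
-/

noncomputable section

open Set Function Complex

namespace Literature.Probability.RandomPlanarGeometry.SAW.YangBaxter

open Real

/-! ## §1 Transport of visited faces, arc kinds and freeness along a translation of the mid-edges -/

namespace YBWalk

section ShiftMids

variable {D D' : Set Face} {a z a' z' : MidEdge} {v : ℤ × ℤ} {γ : YBWalk D a z} {δ : YBWalk D' a' z'}

/-- A walk whose mid-edges are the translated mid-edges visits the translated faces.
[cite: GlazmanManolescu2019, §4.2 (translation invariance)] -/
theorem facesVisited_eq_of_mids_shift (hm : δ.mids = γ.mids.map (MidEdge.shiftBy v)) :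
    δ.facesVisited = γ.facesVisited.map ⟨_, Face.shiftBy_injective v⟩ := by
  have key := facesVisited_shiftBy v γ
  unfold facesVisited arcs at key ⊢
  rw [mids_shiftBy] at key
  rw [hm]
  exact key

/-- … with the same arc kinds in corresponding faces. [cite: GlazmanManolescu2019, §4.2 (translation invariance)] -/
theorem kindsIn_eq_of_mids_shift (hm : δ.mids = γ.mids.map (MidEdge.shiftBy v)) (f : Face) :
    δ.kindsIn (Face.shiftBy v f) = γ.kindsIn f := by
  have key := kindsIn_shiftBy v γ f
  unfold kindsIn arcs at key ⊢
  rw [mids_shiftBy] at key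
  rw [hm]
  exact key

/-- **`w₂`-freeness is translation invariant** (no rhombus other than the translated `r` carries two `(π − θ)`-corner
arcs). [cite: GlazmanManolescu2019, §1, Fig. 1, §4.2 (translation invariance)] -/
theorem W2FreeOff_of_mids_shift (hm : δ.mids = γ.mids.map (MidEdge.shiftBy v)) {r : Face} (hfree : γ.W2FreeOff r) :
    δ.W2FreeOff (Face.shiftBy v r) := by
  intro g hg hne
  rw [facesVisited_eq_of_mids_shift hm, Finset.mem_map] at hg
  obtain ⟨g₀, hg₀, rfl⟩ := hg
  simp only [Function.Embedding.coeFn_mk] at hne ⊢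
  rw [kindsIn_eq_of_mids_shift hm]
  exact hfree g₀ hg₀ fun e => hne (by rw [e])

/-- **`w₁`-freeness is translation invariant.** [cite: GlazmanManolescu2019, §1, Fig. 1, §4.2 (translation invariance)] -/
theorem W1FreeOff_of_mids_shift (hm : δ.mids = γ.mids.map (MidEdge.shiftBy v)) {r : Face} (hfree : γ.W1FreeOff r) :
    δ.W1FreeOff (Face.shiftBy v r) := by
  intro g hg hne
  rw [facesVisited_eq_of_mids_shift hm, Finset.mem_map] at hg
  obtain ⟨g₀, hg₀, rfl⟩ := hg
  simp only [Function.Embedding.coeFn_mk] at hne ⊢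
  rw [kindsIn_eq_of_mids_shift hm]
  exact hfree g₀ hg₀ fun e => hne (by rw [e])

end ShiftMids

end YBWalk

end Literature.Probability.RandomPlanarGeometry.SAW.YangBaxter

namespace Literature.Barriers.CriticalPhenomena.PlaquetteWalk

open Literature.Probability.RandomPlanarGeometry.SAW.YangBaxter
open Real Complex

/-! ## §2 The four interior witnesses at the reference position `w = (4, 2)` -/

section Reference

/-- The block of the `K_S2`-interior witness: 22 cells, one column (`0`) and one row (`−1`) beyond the absent corner cell
`K_S2 = (1, 0)` of the reference root plaquette `(4, 2)` (hole `(3, 2)`, far cell `(2, 2)`).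
[cite: GlazmanManolescu2019, §2.1 (finite domains of faces)] -/
def interiorBlockSW42 : List Face :=
  [(0,-1),(0,0),(0,1),(0,2),(1,-1),(1,2),(2,-1),(2,1),(2,2),(2,3),(3,-1),(3,1),(3,3),(4,-1),(4,1),(4,2),(4,3),
    (5,-1),(5,0),(5,1),(5,2),(5,3)]

/-- The block of the `K_N1`-interior witness (row mirror of `interiorBlockSW42`). [cite: GlazmanManolescu2019, §2.1 (finite domains of faces)] -/
def interiorBlockNW42 : List Face :=
  [(0,2),(0,3),(0,4),(0,5),(1,2),(1,5),(2,1),(2,2),(2,3),(2,5),(3,1),(3,3),(3,5),(4,1),(4,2),(4,3),(4,5),(5,1),(5,2),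
    (5,3),(5,4),(5,5)]

/-- The block of the `K_S1`-interior witness: 20 cells, one column (`6`) and one row (`−1`) beyond the absent corner
cell `K_S1 = (5, 0)`. [cite: GlazmanManolescu2019, §2.1 (finite domains of faces)] -/
def interiorBlockSE42 : List Face :=
  [(1,1),(1,2),(2,0),(2,1),(2,2),(2,3),(3,0),(3,1),(3,3),(4,-1),(4,0),(4,1),(4,2),(4,3),(5,-1),(5,1),(5,2),(6,-1),(6,0),
    (6,1)]

/-- The block of the `K_N2`-interior witness (row mirror of `interiorBlockSE42`). [cite: GlazmanManolescu2019, §2.1 (finite domains of faces)] -/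
def interiorBlockNE42 : List Face :=
  [(1,2),(1,3),(2,1),(2,2),(2,3),(2,4),(3,1),(3,3),(3,4),(4,1),(4,2),(4,3),(4,4),(4,5),(5,2),(5,3),(5,5),(6,3),(6,4),
    (6,5)]

/-- The mid-edges of the `K_S2`-interior witness: an UNDER-walk (first side `S`) that leaves the far cell westwards,
descends column `0`, runs along row `−1`, climbs column `5` and returns over the hole — wound, and `w₂`-free off the far
cell. [cite: GlazmanManolescu2019, §1 (definition of the model), Fig. 1] -/
def interiorUnderSWMids : List MidEdge :=
  [.vert 4 2, .slant 4 2, .vert 4 1, .vert 3 1, .slant 2 2, .vert 2 2, .vert 1 2, .slant 0 2, .slant 0 1, .slant 0 0,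
    .vert 1 (-1), .vert 2 (-1), .vert 3 (-1), .vert 4 (-1), .vert 5 (-1), .slant 5 0, .slant 5 1, .slant 5 2, .slant 5 3,
    .vert 5 3, .vert 4 3, .vert 3 3, .slant 2 3]

/-- The mid-edges of the `K_N1`-interior witness (row mirror): an OVER-walk, wound, `w₁`-free off the far cell.
[cite: GlazmanManolescu2019, §1 (definition of the model), Fig. 1] -/
def interiorOverNWMids : List MidEdge :=
  [.vert 4 2, .slant 4 3, .vert 4 3, .vert 3 3, .slant 2 3, .vert 2 2, .vert 1 2, .slant 0 3, .slant 0 4, .slant 0 5,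
    .vert 1 5, .vert 2 5, .vert 3 5, .vert 4 5, .vert 5 5, .slant 5 5, .slant 5 4, .slant 5 3, .slant 5 2, .vert 5 1,
    .vert 4 1, .vert 3 1, .slant 2 2]

/-- The mid-edges of the `K_S1`-interior witness: an UNDER-walk that rounds the far cell's western neighbour, descends
through the pocket below the root plaquette to row `−1`, climbs column `6` — wound, `w₁`-free off the far cell.
[cite: GlazmanManolescu2019, §1 (definition of the model), Fig. 1] -/
def interiorUnderSEMids : List MidEdge :=
  [.vert 4 2, .slant 4 2, .vert 4 1, .vert 3 1, .slant 2 2, .vert 2 2, .slant 1 2, .vert 2 1, .slant 2 1, .vert 3 0,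
    .vert 4 0, .slant 4 0, .vert 5 (-1), .vert 6 (-1), .slant 6 0, .slant 6 1, .vert 6 1, .slant 5 2, .vert 5 2,
    .slant 4 3, .vert 4 3, .vert 3 3, .slant 2 3]

/-- The mid-edges of the `K_N2`-interior witness (row mirror): an OVER-walk, wound, `w₂`-free off the far cell.
[cite: GlazmanManolescu2019, §1 (definition of the model), Fig. 1] -/
def interiorOverNEMids : List MidEdge :=
  [.vert 4 2, .slant 4 3, .vert 4 3, .vert 3 3, .slant 2 3, .vert 2 2, .slant 1 3, .vert 2 3, .slant 2 4, .vert 3 4,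
    .vert 4 4, .slant 4 5, .vert 5 5, .vert 6 5, .slant 6 5, .slant 6 4, .vert 6 3, .slant 5 3, .vert 5 2, .slant 4 2,
    .vert 4 1, .vert 3 1, .slant 2 2]

/-- The `K_S2`-interior witness as a walk of its block. [cite: GlazmanManolescu2019, §1 (definition of the model), Fig. 1] -/
def interiorUnderSW42 : YBWalk (dom interiorBlockSW42) (w42.side .W) ((farW w42).side .N) where
  mids := interiorUnderSWMids
  head_eq := by decide
  getLast_eq := by decide
  nodup := by decide
  arc_mem := arc_mem_of_check (by decide)
  isChain := by decide
  noncross := noncross_of_check (by decide)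

/-- The `K_N1`-interior witness as a walk of its block. [cite: GlazmanManolescu2019, §1 (definition of the model), Fig. 1] -/
def interiorOverNW42 : YBWalk (dom interiorBlockNW42) (w42.side .W) ((farW w42).side .S) where
  mids := interiorOverNWMids
  head_eq := by decide
  getLast_eq := by decide
  nodup := by decide
  arc_mem := arc_mem_of_check (by decide)
  isChain := by decide
  noncross := noncross_of_check (by decide)

/-- The `K_S1`-interior witness as a walk of its block. [cite: GlazmanManolescu2019, §1 (definition of the model), Fig. 1] -/
def interiorUnderSE42 : YBWalk (dom interiorBlockSE42) (w42.side .W) ((farW w42).side .N) where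
  mids := interiorUnderSEMids
  head_eq := by decide
  getLast_eq := by decide
  nodup := by decide
  arc_mem := arc_mem_of_check (by decide)
  isChain := by decide
  noncross := noncross_of_check (by decide)

/-- The `K_N2`-interior witness as a walk of its block. [cite: GlazmanManolescu2019, §1 (definition of the model), Fig. 1] -/
def interiorOverNE42 : YBWalk (dom interiorBlockNE42) (w42.side .W) ((farW w42).side .S) where
  mids := interiorOverNEMids
  head_eq := by decide
  getLast_eq := by decide
  nodup := by decide
  arc_mem := arc_mem_of_check (by decide)
  isChain := by decide
  noncross := noncross_of_check (by decide)

/-- The labelled `K_S2`-interior witness. [cite: Glazman2015WeightedSAW, Lemma 3.1 (proof, pp. 6–7: the classes of walks through a rhombus)] -/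
def ωISW : ΩG (dom interiorBlockSW42) (w42.side .W) (farW w42) := ⟨.N, interiorUnderSW42⟩

/-- The labelled `K_N1`-interior witness. [cite: Glazman2015WeightedSAW, Lemma 3.1 (proof, pp. 6–7)] -/
def ωINW : ΩG (dom interiorBlockNW42) (w42.side .W) (farW w42) := ⟨.S, interiorOverNW42⟩

/-- The labelled `K_S1`-interior witness. [cite: Glazman2015WeightedSAW, Lemma 3.1 (proof, pp. 6–7)] -/
def ωISE : ΩG (dom interiorBlockSE42) (w42.side .W) (farW w42) := ⟨.N, interiorUnderSE42⟩

/-- The labelled `K_N2`-interior witness. [cite: Glazman2015WeightedSAW, Lemma 3.1 (proof, pp. 6–7)] -/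
def ωINE : ΩG (dom interiorBlockNE42) (w42.side .W) (farW w42) := ⟨.S, interiorOverNE42⟩

/-- Certificates of the `K_S2`-interior witness: first hit `4`, `22` arcs, no later arc in the far cell, first side `S`
(under), `w₂`-free off the far cell, ONE eastern-ray crossing. [cite: Glazman2015WeightedSAW, Lemma 3.1 (proof, pp. 6–7)]
[cite: CourantRobbins1958, Ch. V Appendix §2 (the even–odd rule)] -/
theorem ωISW_cert : ωISW.2.firstHitG = 4 ∧ ωISW.2.arcs.length = 22 ∧ (∀ j < 22, 4 < j → ωISW.2.fc j ≠ farW w42) ∧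
    ωISW.2.nth 4 = (farW w42).side .S ∧ ωISW.2.W2FreeOff (farW w42) ∧
    Odd ((Finset.range 18).filter fun j => eastRayB w42 (ωISW.2.nth (4 + j + 1)) = true).card := by
  refine ⟨by decide, by decide, by decide, by decide, by unfold YBWalk.W2FreeOff; decide, by decide⟩

/-- Certificates of the `K_N1`-interior witness: first side `N` (over), `w₁`-free. [cite: Glazman2015WeightedSAW, Lemma 3.1 (proof, pp. 6–7)]
[cite: CourantRobbins1958, Ch. V Appendix §2 (the even–odd rule)] -/
theorem ωINW_cert : ωINW.2.firstHitG = 4 ∧ ωINW.2.arcs.length = 22 ∧ (∀ j < 22, 4 < j → ωINW.2.fc j ≠ farW w42) ∧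
    ωINW.2.nth 4 = (farW w42).side .N ∧ ωINW.2.W1FreeOff (farW w42) ∧
    Odd ((Finset.range 18).filter fun j => eastRayB w42 (ωINW.2.nth (4 + j + 1)) = true).card := by
  refine ⟨by decide, by decide, by decide, by decide, by unfold YBWalk.W1FreeOff; decide, by decide⟩

/-- Certificates of the `K_S1`-interior witness: first side `S` (under), `w₁`-free. [cite: Glazman2015WeightedSAW, Lemma 3.1 (proof, pp. 6–7)]
[cite: CourantRobbins1958, Ch. V Appendix §2 (the even–odd rule)] -/
theorem ωISE_cert : ωISE.2.firstHitG = 4 ∧ ωISE.2.arcs.length = 22 ∧ (∀ j < 22, 4 < j → ωISE.2.fc j ≠ farW w42) ∧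
    ωISE.2.nth 4 = (farW w42).side .S ∧ ωISE.2.W1FreeOff (farW w42) ∧
    Odd ((Finset.range 18).filter fun j => eastRayB w42 (ωISE.2.nth (4 + j + 1)) = true).card := by
  refine ⟨by decide, by decide, by decide, by decide, by unfold YBWalk.W1FreeOff; decide, by decide⟩

/-- Certificates of the `K_N2`-interior witness: first side `N` (over), `w₂`-free. [cite: Glazman2015WeightedSAW, Lemma 3.1 (proof, pp. 6–7)]
[cite: CourantRobbins1958, Ch. V Appendix §2 (the even–odd rule)] -/
theorem ωINE_cert : ωINE.2.firstHitG = 4 ∧ ωINE.2.arcs.length = 22 ∧ (∀ j < 22, 4 < j → ωINE.2.fc j ≠ farW w42) ∧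
    ωINE.2.nth 4 = (farW w42).side .N ∧ ωINE.2.W2FreeOff (farW w42) ∧
    Odd ((Finset.range 18).filter fun j => eastRayB w42 (ωINE.2.nth (4 + j + 1)) = true).card := by
  refine ⟨by decide, by decide, by decide, by decide, by unfold YBWalk.W2FreeOff; decide, by decide⟩

end Reference

/-! ## §3 Every position: a translate of the block inside the domain carries a translated witness -/

section Translate

/-- The block of the `K_S2`-interior witness at the root plaquette `w`. [cite: GlazmanManolescu2019, §2.1, §4.2 (translation invariance)] -/
def interiorBlockSW (w : Face) : List Face := interiorBlockSW42.map (Face.shiftBy (refShift w))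

/-- The block of the `K_N1`-interior witness at `w`. [cite: GlazmanManolescu2019, §2.1, §4.2 (translation invariance)] -/
def interiorBlockNW (w : Face) : List Face := interiorBlockNW42.map (Face.shiftBy (refShift w))

/-- The block of the `K_S1`-interior witness at `w`. [cite: GlazmanManolescu2019, §2.1, §4.2 (translation invariance)] -/
def interiorBlockSE (w : Face) : List Face := interiorBlockSE42.map (Face.shiftBy (refShift w))

/-- The block of the `K_N2`-interior witness at `w`. [cite: GlazmanManolescu2019, §2.1, §4.2 (translation invariance)] -/
def interiorBlockNE (w : Face) : List Face := interiorBlockNE42.map (Face.shiftBy (refShift w))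

variable {Dl : List Face} {w : Face}

/-- A translate of a block inside `Dl` puts the block inside the back-translated list.
[cite: GlazmanManolescu2019, §4.2 (translation invariance)] -/
theorem block42_mem_of_block_mem {B : List Face} (hB : ∀ c ∈ B.map (Face.shiftBy (refShift w)), c ∈ Dl) :
    ∀ c ∈ B, c ∈ Dl.map (Face.shiftBy (-refShift w)) := fun c hc =>
  (mem_dom_map_shiftBy_neg (refShift w) Dl c).2 (hB _ (List.mem_map.2 ⟨c, hc, rfl⟩))

/-- The domain of the back-translated list, translated forward, is the domain.
[cite: GlazmanManolescu2019, §4.2 (translation invariance)] -/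
theorem preimage_dom_map_shiftBy_neg (v : ℤ × ℤ) (Dl : List Face) :
    Face.shiftBy (-v) ⁻¹' dom (Dl.map (Face.shiftBy (-v))) = dom Dl := by
  ext c
  rw [Set.mem_preimage, mem_dom_map_shiftBy_neg, Face.shiftBy_neg_shiftBy]

/-- The rooted far cell at the reference position, from the rooted far cell at the translated position.
[cite: GlazmanManolescu2019, §2.1 (walks start on the boundary of the domain), §4.2] -/
theorem rootedFace_refShift_back {a' : MidEdge} {r' : Face} (ha : (w42.side .W).shiftBy (refShift w) = a')
    (hrr : Face.shiftBy (refShift w) (farW w42) = r') (hr : RootedFace (dom Dl) a' r') :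
    RootedFace (dom (Dl.map (Face.shiftBy (-refShift w)))) (w42.side .W) (farW w42) := by
  subst ha hrr
  refine ⟨(mem_dom_map_shiftBy_neg _ Dl _).2 hr.mem, fun hb => hr.root ?_⟩
  rw [MidEdge.faces_shiftBy]
  exact ⟨(mem_dom_map_shiftBy_neg _ Dl _).1 hb.1, (mem_dom_map_shiftBy_neg _ Dl _).1 hb.2⟩

/-- ★★★ **TRANSPORT OF A FREE WOUND WITNESS TO EVERY POSITION** (master form, endpoints as free variables): a class-`B2a`
walk of the back-translated list at the reference position with first hit `F`, first side `s`, odd eastern-ray count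
and a freeness property preserved along translations of the mid-edges yields, in `dom Dl` at the translated root and far
cell, a class-`B2a` walk with first side `s`, WOUND at every angle, with that property.
[cite: GlazmanManolescu2019, §4.2 (translation invariance), Lemma 2.1] [cite: Glazman2015WeightedSAW, Lemma 3.1 (proof, pp. 6–7)]
[cite: CourantRobbins1958, Ch. V Appendix §2 (the even–odd rule)] -/
theorem exists_wound_witness_shift {a' : MidEdge} {r' : Face} (ha : (w42.side .W).shiftBy (refShift w) = a')
    (hrr : Face.shiftBy (refShift w) (farW w42) = r') (hr : RootedFace (dom Dl) a' r')
    (P : ∀ {D : Set Face} {a z : MidEdge}, YBWalk D a z → Face → Prop)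
    (hP : ∀ {D D' : Set Face} {a z a'' z'' : MidEdge} {v : ℤ × ℤ} {γ : YBWalk D a z} {δ : YBWalk D' a'' z''},
      δ.mids = γ.mids.map (MidEdge.shiftBy v) → ∀ {r : Face}, P γ r → P δ (Face.shiftBy v r))
    (ω₀ : ΩG (dom (Dl.map (Face.shiftBy (-refShift w)))) (w42.side .W) (farW w42)) (h₀ : ω₀.IsB2a) {s : Side}
    (hs : ω₀.2.nth ω₀.2.firstHitG = (farW w42).side s) (hfree : P ω₀.2 (farW w42))
    (hodd : Odd ((Finset.range ω₀.Mv).filter fun j => eastRayB w42 (ω₀.2.nth (ω₀.2.firstHitG + j + 1)) = true).card)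
    (θ : ℝ) :
    ∃ (ω : ΩG (dom Dl) a' r') (h : ω.IsB2a), ω.2.firstSideG = s ∧
      ω.WE (fun _ => θ) ≠ excursionWinding θ ω.2.firstSideG (ω.z1 hr h) ω.1 ∧ P ω.2 r' := by
  subst ha hrr
  have hr₀ : RootedFace (dom (Dl.map (Face.shiftBy (-refShift w)))) (w42.side .W) (farW w42) :=
    rootedFace_refShift_back rfl rfl hr
  -- the translated walk, typed at the translated endpoints
  let ω : ΩG (dom Dl) ((w42.side .W).shiftBy (refShift w)) (Face.shiftBy (refShift w) (farW w42)) :=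
    ⟨ω₀.1, (ω₀.2.shiftBy (refShift w)).castAll (preimage_dom_map_shiftBy_neg (refShift w) Dl) rfl
      (Face.side_shiftBy (refShift w) (farW w42) ω₀.1).symm⟩
  have hm : ω.2.mids = ω₀.2.mids.map (MidEdge.shiftBy (refShift w)) := rfl
  have h : ω.IsB2a := ΩG.isB2a_of_mids_shift hr₀ hm h₀
  refine ⟨ω, h, ?_, ?_, hP hm hfree⟩
  · refine ΩG.firstSideG_eq_of_nth ω ?_
    rw [YBWalk.firstHitG_eq_of_mids_shift hm, YBWalk.nth_eq_of_mids_shift hm, hs, Face.side_shiftBy]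
  · -- woundness: odd eastern ray count ⇒ AJ ≠ 0 at the reference ⇒ odd `W`-ray count of the root plaquette, which
    -- is translation invariant ⇒ AJ ≠ 0 ⇒ wound, at the translated position
    have hA₀ := (ω₀.WE_ne_excursionWinding_iff_AJ_root_ne_zero hr₀ h₀ θ).1
      (ΩG.WE_ne_excursionWinding_of_odd_card ω₀ hr₀ h₀ hodd θ)
    have hW₀ := (ω₀.AJ_root_ne_zero_iff_odd_rayCountAt (hr := hr₀) h₀ (b := w42) (τ := .W) rfl).1 hA₀
    have hW : Odd (ω.rayCountAt hr h (Face.shiftBy (refShift w) w42) .W) := by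
      rw [ΩG.rayCountAt_W_of_mids_shift (hr := hr₀) (hr' := hr) hm h₀ h w42]; exact hW₀
    exact (ω.WE_ne_excursionWinding_iff_AJ_root_ne_zero hr h θ).2
      ((ω.AJ_root_ne_zero_iff_odd_rayCountAt (hr := hr) h (b := Face.shiftBy (refShift w) w42) (τ := .W)
        (Face.side_shiftBy (refShift w) w42 .W)).2 hW)

/-- ★★★★ **THE `K_S2`-INTERIOR WITNESS, EVERY POSITION.** Every face list containing the 22-cell block `interiorBlockSW w`
(one column and one row beyond the absent corner cell `K_S2`, which it avoids) carries a class-`B2a` UNDER-walk at the far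
cell, wound at every angle and `w₂`-FREE off the far cell — the under route is NOT `w₂`-killed.
[cite: GlazmanManolescu2019, §1 (Fig. 2: the weight w₂), §4.2, Lemma 2.1] [cite: Glazman2015WeightedSAW, Lemma 3.1 (proof, pp. 6–7)]
[cite: CourantRobbins1958, Ch. V Appendix §2 (the even–odd rule)] -/
theorem exists_under_w2free_of_interiorBlockSW (hB : ∀ c ∈ interiorBlockSW w, c ∈ Dl)
    (hr : RootedFace (dom Dl) (w.side .W) (farW w)) (θ : ℝ) :
    ∃ (ω : ΩG (dom Dl) (w.side .W) (farW w)) (h : ω.IsB2a), ω.2.firstSideG = .S ∧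
      ω.WE (fun _ => θ) ≠ excursionWinding θ ω.2.firstSideG (ω.z1 hr h) ω.1 ∧ ω.2.W2FreeOff (farW w) := by
  have hB₀ := block42_mem_of_block_mem (B := interiorBlockSW42) hB
  obtain ⟨hF, hn, hfc, hnth, hfree, hodd⟩ := ωISW_cert
  let ω₀ : ΩG (dom (Dl.map (Face.shiftBy (-refShift w)))) (w42.side .W) (farW w42) :=
    ⟨.N, interiorUnderSW42.mapDomain fun c hc => hB₀ c hc⟩
  have hF' : ω₀.2.firstHitG = 4 := hF
  have hn' : ω₀.2.arcs.length = 22 := hn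
  have h₀ : ω₀.IsB2a := by
    refine ΩG.isB2a_of_forall_fc_ne (by rw [hF', hn']; omega) fun j hj1 hj2 => ?_
    rw [hF'] at hj1
    rw [hn'] at hj2
    exact hfc j hj2 hj1
  have hM : ω₀.Mv = 18 := by unfold ΩG.Mv; rw [hF', hn']
  exact exists_wound_witness_shift (shiftBy_refShift_root w) (shiftBy_refShift_farW w) hr
    (fun γ r => γ.W2FreeOff r) (fun hm _ hf => YBWalk.W2FreeOff_of_mids_shift hm hf) ω₀ h₀
    (by rw [hF']; exact hnth) hfree (by rw [hM, hF']; exact hodd) θ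

/-- ★★★★ **THE `K_N1`-INTERIOR WITNESS, EVERY POSITION**: block `interiorBlockNW w` ⇒ a wound OVER-walk, `w₁`-free off the
far cell — the over route is NOT `w₁`-killed. [cite: GlazmanManolescu2019, §1 (remark after eq. (1): the weight w₁), §4.2, Lemma 2.1]
[cite: Glazman2015WeightedSAW, Lemma 3.1 (proof, pp. 6–7)] [cite: CourantRobbins1958, Ch. V Appendix §2 (the even–odd rule)] -/
theorem exists_over_w1free_of_interiorBlockNW (hB : ∀ c ∈ interiorBlockNW w, c ∈ Dl)
    (hr : RootedFace (dom Dl) (w.side .W) (farW w)) (θ : ℝ) :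
    ∃ (ω : ΩG (dom Dl) (w.side .W) (farW w)) (h : ω.IsB2a), ω.2.firstSideG = .N ∧
      ω.WE (fun _ => θ) ≠ excursionWinding θ ω.2.firstSideG (ω.z1 hr h) ω.1 ∧ ω.2.W1FreeOff (farW w) := by
  have hB₀ := block42_mem_of_block_mem (B := interiorBlockNW42) hB
  obtain ⟨hF, hn, hfc, hnth, hfree, hodd⟩ := ωINW_cert
  let ω₀ : ΩG (dom (Dl.map (Face.shiftBy (-refShift w)))) (w42.side .W) (farW w42) :=
    ⟨.S, interiorOverNW42.mapDomain fun c hc => hB₀ c hc⟩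
  have hF' : ω₀.2.firstHitG = 4 := hF
  have hn' : ω₀.2.arcs.length = 22 := hn
  have h₀ : ω₀.IsB2a := by
    refine ΩG.isB2a_of_forall_fc_ne (by rw [hF', hn']; omega) fun j hj1 hj2 => ?_
    rw [hF'] at hj1
    rw [hn'] at hj2
    exact hfc j hj2 hj1
  have hM : ω₀.Mv = 18 := by unfold ΩG.Mv; rw [hF', hn']
  exact exists_wound_witness_shift (shiftBy_refShift_root w) (shiftBy_refShift_farW w) hr
    (fun γ r => γ.W1FreeOff r) (fun hm _ hf => YBWalk.W1FreeOff_of_mids_shift hm hf) ω₀ h₀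
    (by rw [hF']; exact hnth) hfree (by rw [hM, hF']; exact hodd) θ

/-- ★★★★ **THE `K_S1`-INTERIOR WITNESS, EVERY POSITION**: block `interiorBlockSE w` ⇒ a wound UNDER-walk, `w₁`-free off
the far cell — the under route is NOT `w₁`-killed. [cite: GlazmanManolescu2019, §1 (remark after eq. (1)), §4.2, Lemma 2.1]
[cite: Glazman2015WeightedSAW, Lemma 3.1 (proof, pp. 6–7)] [cite: CourantRobbins1958, Ch. V Appendix §2 (the even–odd rule)] -/
theorem exists_under_w1free_of_interiorBlockSE (hB : ∀ c ∈ interiorBlockSE w, c ∈ Dl)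
    (hr : RootedFace (dom Dl) (w.side .W) (farW w)) (θ : ℝ) :
    ∃ (ω : ΩG (dom Dl) (w.side .W) (farW w)) (h : ω.IsB2a), ω.2.firstSideG = .S ∧
      ω.WE (fun _ => θ) ≠ excursionWinding θ ω.2.firstSideG (ω.z1 hr h) ω.1 ∧ ω.2.W1FreeOff (farW w) := by
  have hB₀ := block42_mem_of_block_mem (B := interiorBlockSE42) hB
  obtain ⟨hF, hn, hfc, hnth, hfree, hodd⟩ := ωISE_cert
  let ω₀ : ΩG (dom (Dl.map (Face.shiftBy (-refShift w)))) (w42.side .W) (farW w42) :=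
    ⟨.N, interiorUnderSE42.mapDomain fun c hc => hB₀ c hc⟩
  have hF' : ω₀.2.firstHitG = 4 := hF
  have hn' : ω₀.2.arcs.length = 22 := hn
  have h₀ : ω₀.IsB2a := by
    refine ΩG.isB2a_of_forall_fc_ne (by rw [hF', hn']; omega) fun j hj1 hj2 => ?_
    rw [hF'] at hj1
    rw [hn'] at hj2
    exact hfc j hj2 hj1
  have hM : ω₀.Mv = 18 := by unfold ΩG.Mv; rw [hF', hn']
  exact exists_wound_witness_shift (shiftBy_refShift_root w) (shiftBy_refShift_farW w) hr
    (fun γ r => γ.W1FreeOff r) (fun hm _ hf => YBWalk.W1FreeOff_of_mids_shift hm hf) ω₀ h₀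
    (by rw [hF']; exact hnth) hfree (by rw [hM, hF']; exact hodd) θ

/-- ★★★★ **THE `K_N2`-INTERIOR WITNESS, EVERY POSITION**: block `interiorBlockNE w` ⇒ a wound OVER-walk, `w₂`-free off the
far cell — the over route is NOT `w₂`-killed. [cite: GlazmanManolescu2019, §1 (Fig. 2), §4.2, Lemma 2.1]
[cite: Glazman2015WeightedSAW, Lemma 3.1 (proof, pp. 6–7)] [cite: CourantRobbins1958, Ch. V Appendix §2 (the even–odd rule)] -/
theorem exists_over_w2free_of_interiorBlockNE (hB : ∀ c ∈ interiorBlockNE w, c ∈ Dl)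
    (hr : RootedFace (dom Dl) (w.side .W) (farW w)) (θ : ℝ) :
    ∃ (ω : ΩG (dom Dl) (w.side .W) (farW w)) (h : ω.IsB2a), ω.2.firstSideG = .N ∧
      ω.WE (fun _ => θ) ≠ excursionWinding θ ω.2.firstSideG (ω.z1 hr h) ω.1 ∧ ω.2.W2FreeOff (farW w) := by
  have hB₀ := block42_mem_of_block_mem (B := interiorBlockNE42) hB
  obtain ⟨hF, hn, hfc, hnth, hfree, hodd⟩ := ωINE_cert
  let ω₀ : ΩG (dom (Dl.map (Face.shiftBy (-refShift w)))) (w42.side .W) (farW w42) :=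
    ⟨.S, interiorOverNE42.mapDomain fun c hc => hB₀ c hc⟩
  have hF' : ω₀.2.firstHitG = 4 := hF
  have hn' : ω₀.2.arcs.length = 22 := hn
  have h₀ : ω₀.IsB2a := by
    refine ΩG.isB2a_of_forall_fc_ne (by rw [hF', hn']; omega) fun j hj1 hj2 => ?_
    rw [hF'] at hj1
    rw [hn'] at hj2
    exact hfc j hj2 hj1
  have hM : ω₀.Mv = 18 := by unfold ΩG.Mv; rw [hF', hn']
  exact exists_wound_witness_shift (shiftBy_refShift_root w) (shiftBy_refShift_farW w) hr
    (fun γ r => γ.W2FreeOff r) (fun hm _ hf => YBWalk.W2FreeOff_of_mids_shift hm hf) ω₀ h₀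
    (by rw [hF']; exact hnth) hfree (by rw [hM, hF']; exact hodd) θ

/-! ## §4 No kill from an interior corner cell -/

/-- ★ **An absent `K_S2` that is not on the boundary side of its pocket does not `w₂`-kill the under route**: with the block
`interiorBlockSW w` present it is false that every wound under-walk is `w₂`-marked off the far cell.
[cite: GlazmanManolescu2019, §1 (Fig. 2), Lemma 2.1] [cite: Glazman2015WeightedSAW, Lemma 3.1 (proof, pp. 6–7)] -/
theorem not_under_w2_killed_of_interiorBlockSW (hB : ∀ c ∈ interiorBlockSW w, c ∈ Dl)
    (hr : RootedFace (dom Dl) (w.side .W) (farW w)) (θ : ℝ) :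
    ¬ ∀ (ω : ΩG (dom Dl) (w.side .W) (farW w)) (h : ω.IsB2a), ω.2.firstSideG = .S →
      ω.WE (fun _ => θ) ≠ excursionWinding θ ω.2.firstSideG (ω.z1 hr h) ω.1 → ¬ω.2.W2FreeOff (farW w) := by
  intro hkill
  obtain ⟨ω, h, hS, hW, hfree⟩ := exists_under_w2free_of_interiorBlockSW hB hr θ
  exact hkill ω h hS hW hfree

/-- ★ An absent interior `K_N1` does not `w₁`-kill the over route. [cite: GlazmanManolescu2019, §1 (remark after eq. (1)), Lemma 2.1]
[cite: Glazman2015WeightedSAW, Lemma 3.1 (proof, pp. 6–7)] -/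
theorem not_over_w1_killed_of_interiorBlockNW (hB : ∀ c ∈ interiorBlockNW w, c ∈ Dl)
    (hr : RootedFace (dom Dl) (w.side .W) (farW w)) (θ : ℝ) :
    ¬ ∀ (ω : ΩG (dom Dl) (w.side .W) (farW w)) (h : ω.IsB2a), ω.2.firstSideG = .N →
      ω.WE (fun _ => θ) ≠ excursionWinding θ ω.2.firstSideG (ω.z1 hr h) ω.1 → ¬ω.2.W1FreeOff (farW w) := by
  intro hkill
  obtain ⟨ω, h, hN, hW, hfree⟩ := exists_over_w1free_of_interiorBlockNW hB hr θ
  exact hkill ω h hN hW hfree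

/-- ★ An absent interior `K_S1` does not `w₁`-kill the under route. [cite: GlazmanManolescu2019, §1 (remark after eq. (1)), Lemma 2.1]
[cite: Glazman2015WeightedSAW, Lemma 3.1 (proof, pp. 6–7)] -/
theorem not_under_w1_killed_of_interiorBlockSE (hB : ∀ c ∈ interiorBlockSE w, c ∈ Dl)
    (hr : RootedFace (dom Dl) (w.side .W) (farW w)) (θ : ℝ) :
    ¬ ∀ (ω : ΩG (dom Dl) (w.side .W) (farW w)) (h : ω.IsB2a), ω.2.firstSideG = .S →
      ω.WE (fun _ => θ) ≠ excursionWinding θ ω.2.firstSideG (ω.z1 hr h) ω.1 → ¬ω.2.W1FreeOff (farW w) := by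
  intro hkill
  obtain ⟨ω, h, hS, hW, hfree⟩ := exists_under_w1free_of_interiorBlockSE hB hr θ
  exact hkill ω h hS hW hfree

/-- ★ An absent interior `K_N2` does not `w₂`-kill the over route. [cite: GlazmanManolescu2019, §1 (Fig. 2), Lemma 2.1]
[cite: Glazman2015WeightedSAW, Lemma 3.1 (proof, pp. 6–7)] -/
theorem not_over_w2_killed_of_interiorBlockNE (hB : ∀ c ∈ interiorBlockNE w, c ∈ Dl)
    (hr : RootedFace (dom Dl) (w.side .W) (farW w)) (θ : ℝ) :
    ¬ ∀ (ω : ΩG (dom Dl) (w.side .W) (farW w)) (h : ω.IsB2a), ω.2.firstSideG = .N →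
      ω.WE (fun _ => θ) ≠ excursionWinding θ ω.2.firstSideG (ω.z1 hr h) ω.1 → ¬ω.2.W2FreeOff (farW w) := by
  intro hkill
  obtain ⟨ω, h, hN, hW, hfree⟩ := exists_over_w2free_of_interiorBlockNE hB hr θ
  exact hkill ω h hN hW hfree

end Translate

end Literature.Barriers.CriticalPhenomena.PlaquetteWalk
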